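import Summits.QuantumFields.YangMills.Theses.CovariantDischarge
import Summits.QuantumFields.YangMills.Theorems.CovariantDischargeSandwichCover
import Summits.QuantumFields.YangMills.Theorems.FibreConvexityTailHistoryTailOfTwoSided

/-!
# Route `CovariantDischarge` (rev 1, «SeveritySandwich» repair) — the door `HistoryTailOfSandwichSplit`, PROVED
# (ideator seat `ym-r3-idea-2` gen 13, LINE 24 on crux stmt-QuantumFields-19936 `UnitScaleTilt.HistoryTailL`)

`SandwichFractionalWindowTailL → SandwichDeepWindowTailL →` the body of `UnitScaleTilt.HistoryTailL`.

THE MECHANISM (severity-maximal sandwich re-cover).  Fix a run `K`, `n` free top heights and the LADDER of profiles `b_k = 2^k b₀`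
(thresholds `θ_k = 2^k θ_{b₀}`, `OneStepWindowL.θBal_const_mul`).  A field outside Bałaban's small-history event `histGood θ_{b₀} K n`
is either bare-bad at the unit scale, or — with `k` the MAXIMAL severity at which it is outside `histGood θ_k K n` (a ceiling severity
exists: `2^{k₀} θ_{b₀} > 2 ≥ dist1` on `SU(2)`, `T4PairDerivBridge.dist1_le_two_specialUnitaryGroup`) and `j ≥ 1` the finest `θ_k`-bad
constrained height — inside the SANDWICH event at base `b_k`: finer heights `θ_k`-small, ALL constrained coarser heights `θ_{k+1} =
θ(2 b_k)`-small (maximality), level `j` `θ_k`-bad at a plaquette (`CovariantDischargeSandwichCover` §1, exact — no window trick).  The severities are summed WITHOUT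
counting them (§2): the piece at severity `k` is empty once `2^k θ_{b₀}(K−j) > 2`, so with a ladder-UNIFORM bound `B` per piece the sum is
`≤ Σ_k min(B, 0·…) ≤ 4B/θ_{b₀}(K−j) ≤ 4B·β_{K−j}` (`x ≤ θ_{b₀}(x)` for `b₀ ≥ 1`, §3) — one extra power of `β`, absorbed by the schema.
§4 sums plaquettes and heights with the tree's per-height arithmetic (`HistoryTailOfTwoSided.exists_perHeight_bound`,
`geometric_profile`, `card_plaq_le_pow`) and runs `K, K+1` at `n = ⌊K/m⌋` as in `historyTailAt_of_bare_finestBad`, the bare level by the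
landed `T3BareTailProfile.bareTailAt`; §5 merges the route's two depth ranges (`N₁·j + n ≤ K` / `K < N₁·j + n`) at `Λ = 2`.

WHAT THIS IS NOT: both sandwich tails are OPEN (the fractional one is the repaired load-bearing crux, the deep one a declared
residual) — this file is bookkeeping + elementary measure theory; no tail estimate is proved, rung R3 (`YM3TorusSU2`) is a RECORD
rung, not the Clay statement, and nothing here bears on the Yang–Mills mass gap.

References: T. Bałaban, CMP 102 (1985) 255–275 [Balaban1985UV3] ((7) p.257: `β_k = L^k/γ`, the profile `p(g) = b₀(1+log g⁻¹)^{p₀}`,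
(71) p.273); T. Bałaban, CMP 122 (1989) 355–392 [Balaban1989LargeFieldII] (Thm 1 p.358: the inductive large-field bookkeeping this
re-cover imitates on the history side); C. King, CMP 103 (1986) 323–349 [King1986].
-/

noncomputable section

open MeasureTheory Filter Topology
open Literature.MathematicalPhysics.QuantumFieldTheory.Balaban1983to89
open Literature.MathematicalPhysics.QuantumFieldTheory.Balaban1983to89.Missing
open Literature.MathematicalPhysics.QuantumFieldTheory.Balaban1983to89.T4Continuum
open Literature.MathematicalPhysics.QuantumFieldTheory.Balaban1983to89.T3ContinuumYM3Torus
open Literature.MathematicalPhysics.QuantumFieldTheory.Balaban1983to89.T3UnitScaleTilt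
open Literature.MathematicalPhysics.QuantumFieldTheory.Balaban1983to89.T3UnitLawDensityEML (ℰp measurableE_ℰp)
open Literature.MathematicalPhysics.QuantumFieldTheory.Balaban1983to89.T3HistoryTailReduction
open Literature.MathematicalPhysics.QuantumFieldTheory.Balaban1983to89.T3BareTailProfile
open Literature.MathematicalPhysics.QuantumFieldTheory.Balaban1983to89.T3AveragedTailProfile

namespace Summit.QuantumFields.YangMills.Theorems

namespace SandwichDischargeDoor

/-! ## §4 The reduction: ladder-uniform sandwich bounds + the bare tail ⇒ `HistoryTailAt` -/

section Reduction

open Literature.MathematicalPhysics.QuantumFieldTheory.Balaban1983to89.T3Thresholds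
open Literature.MathematicalPhysics.QuantumFieldTheory.Balaban1983to89.T3MinimiserStabilityReduction (θBal_pos)
open Summit.QuantumFields.YangMills.Theorems.HistoryTailOfTwoSided (exists_perHeight_bound geometric_profile card_plaq_le_pow)

/-- test: the scheme's `β` is the crux's `(γL^{-i})⁻¹` by `rfl`. -/
example (F : T3Family) (γ : ℝ) (i : ℕ) : (F.scheme ℰp γ).β i = (γ * ((F.L : ℝ)⁻¹) ^ i)⁻¹ := rfl

/-- **THE REDUCTION.** A summable bare profile `q₀` at `θ(b₀)` and LADDER-UNIFORM sandwich bounds (base `b ≥ b₀`, coarse base `2b`,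
all constrained heights `j ≥ 1`, `n ≥ 2` free top heights, schema `C·β^N·e^{−c p(b₀)²}`) give `HistoryTailAt F γ b₀ p₀ m` for every `m ≥ 1`
(`b₀ ≥ 1`, `p₀ ≥ 1`, `0 < γ ≤ 1`).  The severities are summed by §2 (a piece at severity `k` is empty once `2^k θ_{b₀} > 2`), the
plaquettes and heights by the tree's per-height arithmetic, the runs `K, K+1` at `n = ⌊K/m⌋` as in `historyTailAt_of_bare_finestBad`. -/
theorem historyTailAt_of_bare_sandwich (F : T3Family) {γ b₀ p₀ : ℝ} (hγ : 0 < γ) (hγ1 : γ ≤ 1) (hb₀ : 1 ≤ b₀) (hp₀ : 1 ≤ p₀)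
    {m : ℕ} (hm : 0 < m) (q₀ : ℕ → ℝ) (hq₀0 : ∀ i, 0 ≤ q₀ i) (hq₀ : Summable q₀)
    (hbare : ∀ K, (gibbsK F ℰp γ K).real {U | ¬ PlaqSmall (θBal F.L γ b₀ p₀ K) U} ≤ q₀ K)
    {C c : ℝ} (hC : 0 ≤ C) (hc : 0 < c) (N : ℕ)
    (hsw : ∀ b : ℝ, b₀ ≤ b → ∀ K n j : ℕ, 1 ≤ j → 2 ≤ n → j + n ≤ K → ∀ p : Plaq (F.P K) j,
      (gibbsK F ℰp γ K).real
          {U | (∀ k, k < j → PlaqSmall (θBal F.L γ b p₀ (K - k))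
                (Averaging.iter (fun i => BlockAveraging.blockAvg (P := F.P K) (j := i) ℰp) k U)) ∧
              (∀ j', j ≤ j' → j' + n ≤ K → PlaqSmall (θBal F.L γ (2 * b) p₀ (K - j'))
                (Averaging.iter (fun i => BlockAveraging.blockAvg (P := F.P K) (j := i) ℰp) j' U)) ∧
              θBal F.L γ b p₀ (K - j) ≤ dist1 (GaugeField.plaqHol
                (Averaging.iter (fun i => BlockAveraging.blockAvg (P := F.P K) (j := i) ℰp) j U) p)}
        ≤ C * ((γ * ((F.L : ℝ)⁻¹) ^ (K - j))⁻¹) ^ N *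
            Real.exp (-(c * B10.pFun b₀ p₀ (Real.sqrt (γ * ((F.L : ℝ)⁻¹) ^ (K - j))) ^ 2))) :
    HistoryTailAt F γ b₀ p₀ m := by
  classical
  have hL : 1 ≤ F.L := F.hL.2.le
  have hb₀0 : 0 < b₀ := one_pos.trans_le hb₀
  have hp₀0 : 0 ≤ p₀ := zero_le_one.trans hp₀
  -- the ladder of thresholds
  let θf : ℕ → ℕ → ℝ := fun k i => θBal F.L γ (2 ^ k * b₀) p₀ i
  let θc : ℕ → ℕ → ℝ := fun k i => θBal F.L γ (2 * (2 ^ k * b₀)) p₀ i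
  have hθf0 : θf 0 = θBal F.L γ b₀ p₀ := by
    funext i; simp [θf]
  have hmono0 : ∀ k i, θf 0 i ≤ θf k i := by
    intro k i
    show θBal F.L γ (2 ^ 0 * b₀) p₀ i ≤ θBal F.L γ (2 ^ k * b₀) p₀ i
    rw [θBal_ladder, θBal_ladder, pow_zero, one_mul]
    exact le_mul_of_one_le_left (θBal_pos hL hγ hγ1 hb₀0 p₀ i).le (one_le_pow₀ (by norm_num : (1 : ℝ) ≤ 2))
  have hlink : ∀ k i, θf (k + 1) i ≤ θc k i := by
    intro k i
    show θBal F.L γ (2 ^ (k + 1) * b₀) p₀ i ≤ θBal F.L γ (2 * (2 ^ k * b₀)) p₀ i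
    rw [show (2 : ℝ) ^ (k + 1) * b₀ = 2 * (2 ^ k * b₀) by ring]
  have hdist : ∀ g : Matrix.specialUnitaryGroup (Fin 2) ℂ, dist1 g ≤ 2 :=
    T4PairDerivBridge.dist1_le_two_specialUnitaryGroup
  -- the geometric per-height profile for the schema `(4C, N+1)`
  obtain ⟨A', hA'0, hph⟩ := exists_perHeight_bound F hγ hγ1 hb₀0 hp₀ (C := 4 * C) (by positivity) (N + 1) hc
  obtain ⟨hq0, hq, hqt⟩ := geometric_profile hA'0
  have hT0 : ∀ n, 0 ≤ ∑' t, A' * ((1 : ℝ) / 2) ^ (t + n) := fun n => tsum_nonneg fun _ => hq0 _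
  -- ONE HEIGHT `j + 1`: severities (§2) and plaquettes summed
  have hheight : ∀ K n j k₀, 2 ≤ n → j + 1 + n ≤ K →
      ∑ k ∈ Finset.range k₀, ∑ p : Plaq (F.P K) (j + 1),
        (gibbsK F ℰp γ K).real
          {U | (∀ i, i < j + 1 → PlaqSmall (θf k (K - i))
                (Averaging.iter (fun i' => BlockAveraging.blockAvg (P := F.P K) (j := i') ℰp) i U)) ∧
             (∀ j', j + 1 ≤ j' → j' + n ≤ K → PlaqSmall (θc k (K - j'))
                (Averaging.iter (fun i' => BlockAveraging.blockAvg (P := F.P K) (j := i') ℰp) j' U)) ∧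
             θf k (K - (j + 1)) ≤ dist1 (GaugeField.plaqHol
                (Averaging.iter (fun i' => BlockAveraging.blockAvg (P := F.P K) (j := i') ℰp) (j + 1) U) p)}
        ≤ A' * ((1 : ℝ) / 2) ^ (K - (j + 1)) := by
    intro K n j k₀ hn hjK
    haveI := isProbabilityMeasure_gibbsK F ℰp hγ.le K
    set i := K - (j + 1) with hi_def
    set x : ℝ := γ * ((F.L : ℝ)⁻¹) ^ i with hx_def
    have hx0 : 0 < x := mul_pos hγ (pow_pos (inv_pos.mpr (by exact_mod_cast hL)) i)
    have hxθ : x ≤ θBal F.L γ b₀ p₀ i := coupling_sq_le_θBal hL hγ hγ1 hb₀ hp₀0 i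
    have hθ0 : 0 < θBal F.L γ b₀ p₀ i := hx0.trans_le hxθ
    set B : ℝ := C * (x⁻¹) ^ N * Real.exp (-(c * B10.pFun b₀ p₀ (Real.sqrt x) ^ 2)) with hB_def
    have hB0 : 0 ≤ B := by positivity
    rw [Finset.sum_comm]
    -- each plaquette: the severities sum to ≤ 4B/θ₀ ≤ 4C·x⁻¹^(N+1)·e
    have hper : ∀ p : Plaq (F.P K) (j + 1),
        ∑ k ∈ Finset.range k₀, (gibbsK F ℰp γ K).real
          {U | (∀ i, i < j + 1 → PlaqSmall (θf k (K - i))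
                (Averaging.iter (fun i' => BlockAveraging.blockAvg (P := F.P K) (j := i') ℰp) i U)) ∧
             (∀ j', j + 1 ≤ j' → j' + n ≤ K → PlaqSmall (θc k (K - j'))
                (Averaging.iter (fun i' => BlockAveraging.blockAvg (P := F.P K) (j := i') ℰp) j' U)) ∧
             θf k (K - (j + 1)) ≤ dist1 (GaugeField.plaqHol
                (Averaging.iter (fun i' => BlockAveraging.blockAvg (P := F.P K) (j := i') ℰp) (j + 1) U) p)}
          ≤ (4 * C) * (x⁻¹) ^ (N + 1) * Real.exp (-(c * B10.pFun b₀ p₀ (Real.sqrt x) ^ 2)) := by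
      intro p
      refine (sum_severity_le (gibbsK F ℰp γ K) _ hθ0 hB0 (fun k => ?_) (fun k hk => ?_) k₀).trans ?_
      · -- the ladder-uniform sandwich bound at base `2^k b₀ ≥ b₀`
        have hb : b₀ ≤ 2 ^ k * b₀ := le_mul_of_one_le_left hb₀0.le (one_le_pow₀ (by norm_num : (1 : ℝ) ≤ 2))
        exact hsw (2 ^ k * b₀) hb K n (j + 1) (by omega) hn hjK p
      · -- empty once `2^k θ_{b₀}(i) > 2 ≥ dist1`
        ext U
        simp only [Set.mem_setOf_eq, Set.mem_empty_iff_false, iff_false, not_and]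
        intro _ _ hle
        have hθk : θf k (K - (j + 1)) = 2 ^ k * θBal F.L γ b₀ p₀ i := θBal_ladder F.L γ b₀ p₀ k i
        exact absurd ((hθk ▸ hle).trans (hdist _)) (not_le.mpr hk)
      · -- 4B/θ₀ ≤ 4B/x = 4C x⁻¹^(N+1) e
        have h1 : 4 * B / θBal F.L γ b₀ p₀ i ≤ 4 * B / x :=
          div_le_div_of_nonneg_left (by positivity) hx0 hxθ
        refine h1.trans (le_of_eq ?_)
        rw [hB_def, pow_succ, div_eq_mul_inv]
        ring
    calc ∑ p : Plaq (F.P K) (j + 1), ∑ k ∈ Finset.range k₀, (gibbsK F ℰp γ K).real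
            {U | (∀ i, i < j + 1 → PlaqSmall (θf k (K - i))
                  (Averaging.iter (fun i' => BlockAveraging.blockAvg (P := F.P K) (j := i') ℰp) i U)) ∧
               (∀ j', j + 1 ≤ j' → j' + n ≤ K → PlaqSmall (θc k (K - j'))
                  (Averaging.iter (fun i' => BlockAveraging.blockAvg (P := F.P K) (j := i') ℰp) j' U)) ∧
               θf k (K - (j + 1)) ≤ dist1 (GaugeField.plaqHol
                  (Averaging.iter (fun i' => BlockAveraging.blockAvg (P := F.P K) (j := i') ℰp) (j + 1) U) p)}
        ≤ ∑ _p : Plaq (F.P K) (j + 1), (4 * C) * (x⁻¹) ^ (N + 1) * Real.exp (-(c * B10.pFun b₀ p₀ (Real.sqrt x) ^ 2)) :=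
          Finset.sum_le_sum fun p _ => hper p
      _ = (Fintype.card (Plaq (F.P K) (j + 1)) : ℝ) *
            ((4 * C) * (x⁻¹) ^ (N + 1) * Real.exp (-(c * B10.pFun b₀ p₀ (Real.sqrt x) ^ 2))) := by
          rw [Finset.sum_const, nsmul_eq_mul, Finset.card_univ]
      _ ≤ (9 * (8 * (F.L : ℝ) ^ (3 * F.m) * ((F.L : ℝ) ^ i) ^ 3)) *
            ((4 * C) * (F.scheme ℰp γ).β i ^ (N + 1) *
              Real.exp (-(c * B10.pFun b₀ p₀ (Real.sqrt (γ * ((F.L : ℝ)⁻¹) ^ i)) ^ 2))) :=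
          mul_le_mul_of_nonneg_right (card_plaq_le_pow F (by omega)) (by positivity)
      _ ≤ A' * ((1 : ℝ) / 2) ^ i := hph i
  -- ONE RUN `K` with `n ≥ 2` free top heights
  have hrun : ∀ K n, 2 ≤ n →
      (gibbsK F ℰp γ K).real (histGood F ℰp (θBal F.L γ b₀ p₀) K n)ᶜ ≤
        q₀ K + ∑' t, A' * ((1 : ℝ) / 2) ^ (t + n) := by
    intro K n hn
    haveI := isProbabilityMeasure_gibbsK F ℰp hγ.le K
    by_cases hnK : n ≤ K
    · obtain ⟨k₀, hk₀⟩ := exists_ceiling hL hγ hγ1 hb₀ hp₀0 K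
      have hcov := real_compl_histGood_le_sandwich F ℰp θf θc K n k₀ hmono0 hlink hdist
        (fun i hi => hk₀ i hi) (gibbsK F ℰp γ K)
      rw [hθf0] at hcov
      refine hcov.trans (add_le_add (hbare K) ?_)
      calc ∑ j ∈ Finset.range (K - n), ∑ k ∈ Finset.range k₀, ∑ p : Plaq (F.P K) (j + 1),
              (gibbsK F ℰp γ K).real
                {U | (∀ i, i < j + 1 → PlaqSmall (θf k (K - i))
                      (Averaging.iter (fun i' => BlockAveraging.blockAvg (P := F.P K) (j := i') ℰp) i U)) ∧
                   (∀ j', j + 1 ≤ j' → j' + n ≤ K → PlaqSmall (θc k (K - j'))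
                      (Averaging.iter (fun i' => BlockAveraging.blockAvg (P := F.P K) (j := i') ℰp) j' U)) ∧
                   θf k (K - (j + 1)) ≤ dist1 (GaugeField.plaqHol
                      (Averaging.iter (fun i' => BlockAveraging.blockAvg (P := F.P K) (j := i') ℰp) (j + 1) U) p)}
          ≤ ∑ j ∈ Finset.range (K - n), A' * ((1 : ℝ) / 2) ^ (K - (j + 1)) :=
            Finset.sum_le_sum fun j hj => hheight K n j k₀ hn (by have := Finset.mem_range.mp hj; omega)
        _ = ∑ j ∈ Finset.range (K - n), A' * ((1 : ℝ) / 2) ^ (j + n) := by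
            rw [← Finset.sum_range_reflect (fun j => A' * ((1 : ℝ) / 2) ^ (j + n)) (K - n)]
            refine Finset.sum_congr rfl fun j hj => ?_
            have := Finset.mem_range.mp hj
            show A' * ((1 : ℝ) / 2) ^ (K - (j + 1)) = A' * ((1 : ℝ) / 2) ^ (K - n - 1 - j + n)
            congr 2
            omega
        _ ≤ ∑' t, A' * ((1 : ℝ) / 2) ^ (t + n) :=
            ((summable_nat_add_iff n).mpr hq).sum_le_tsum _ fun _ _ => hq0 _
    · rw [histGood_of_lt F ℰp (not_le.mp hnK), Set.compl_univ, measureReal_empty]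
      exact add_nonneg (hq₀0 K) (hT0 n)
  -- the summable profile, runs `K` and `K + 1` at `n = ⌊K/m⌋`
  refine ⟨fun K => (if K < 2 * m then (1 : ℝ) else 0) +
      (q₀ K + q₀ (K + 1) + ∑' t, A' * ((1 : ℝ) / 2) ^ (t + K / m)), ?_, fun K => ?_⟩
  · refine Summable.add ?_ ((hq₀.add ((summable_nat_add_iff 1).mpr hq₀)).add
      (summable_comp_div (T := fun n => ∑' t, A' * ((1 : ℝ) / 2) ^ (t + n)) hT0 hqt hm))
    exact summable_of_ne_finset_zero (s := Finset.range (2 * m)) fun K hK =>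
      if_neg (by rwa [Finset.mem_range] at hK)
  · beta_reduce
    have hrest : 0 ≤ q₀ K + q₀ (K + 1) + ∑' t, A' * ((1 : ℝ) / 2) ^ (t + K / m) :=
      add_nonneg (add_nonneg (hq₀0 _) (hq₀0 _)) (hT0 _)
    by_cases hK : K < 2 * m
    · rw [if_pos hK]
      haveI := isProbabilityMeasure_gibbsK F ℰp hγ.le K
      haveI := isProbabilityMeasure_gibbsK F ℰp hγ.le (K + 1)
      exact ⟨measureReal_le_one.trans (le_add_of_nonneg_right hrest),
        measureReal_le_one.trans (le_add_of_nonneg_right hrest)⟩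
    · rw [if_neg hK, zero_add]
      have hn2 : 2 ≤ K / m := (Nat.le_div_iff_mul_le hm).mpr (by omega)
      constructor
      · exact (hrun K (K / m) hn2).trans (by linarith [hq₀0 (K + 1)])
      · exact (hrun (K + 1) (K / m) hn2).trans (by linarith [hq₀0 K])

end Reduction

/-! ## §5 The door: `SandwichFractionalWindowTailL → SandwichDeepWindowTailL →` the body of `UnitScaleTilt.HistoryTailL` -/

section Door

open Summit.QuantumFields.YangMills.Theses.CovariantDischarge

/-- Monotonicity of the schema `C·β^N·e^{−c t}` in `(C, N, c)` for `β ≥ 1`, `t ≥ 0`. [folklore] -/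
theorem sd_schema_mono {x Cx C β cx c t : ℝ} {Nx N : ℕ} (hβ : 1 ≤ β) (hN : Nx ≤ N) (hc : c ≤ cx)
    (ht : 0 ≤ t) (hCx : |Cx| ≤ C) (h : x ≤ Cx * β ^ Nx * Real.exp (-(cx * t))) :
    x ≤ C * β ^ N * Real.exp (-(c * t)) := by
  have hβ0 : 0 ≤ β := zero_le_one.trans hβ
  have h1 : Cx * β ^ Nx * Real.exp (-(cx * t)) ≤ |Cx| * β ^ Nx * Real.exp (-(cx * t)) :=
    mul_le_mul_of_nonneg_right (mul_le_mul_of_nonneg_right (le_abs_self Cx) (pow_nonneg hβ0 Nx))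
      (Real.exp_nonneg _)
  have h2 : |Cx| * β ^ Nx * Real.exp (-(cx * t)) ≤ C * β ^ N * Real.exp (-(c * t)) := by
    have hC0 : 0 ≤ C := (abs_nonneg Cx).trans hCx
    have hpow : β ^ Nx ≤ β ^ N := pow_le_pow_right₀ hβ hN
    have hexp : Real.exp (-(cx * t)) ≤ Real.exp (-(c * t)) :=
      Real.exp_le_exp.mpr (neg_le_neg (mul_le_mul_of_nonneg_right hc ht))
    calc |Cx| * β ^ Nx * Real.exp (-(cx * t)) ≤ C * β ^ N * Real.exp (-(cx * t)) :=
          mul_le_mul_of_nonneg_right (mul_le_mul hCx hpow (pow_nonneg hβ0 Nx) hC0) (Real.exp_nonneg _)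
      _ ≤ C * β ^ N * Real.exp (-(c * t)) :=
          mul_le_mul_of_nonneg_left hexp (mul_nonneg hC0 (pow_nonneg hβ0 N))
  exact h.trans (h1.trans h2)

/-- `1 ≤ β_(K−j) = (γ L^{-(K−j)})⁻¹` on a Bałaban family when `γ ≤ 1`. [folklore] -/
theorem sd_one_le_beta (F : T3Family) {γ : ℝ} (hγ : 0 < γ) (hγ1 : γ ≤ 1) (K j : ℕ) :
    (1 : ℝ) ≤ (γ * ((F.L : ℝ)⁻¹) ^ (K - j))⁻¹ := by
  have hL1 : (1 : ℝ) ≤ F.L := by exact_mod_cast F.hL.2.le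
  have hL0 : (0 : ℝ) < F.L := one_pos.trans_le hL1
  have hq0 : 0 < γ * ((F.L : ℝ)⁻¹) ^ (K - j) := mul_pos hγ (pow_pos (inv_pos.mpr hL0) _)
  have hq1 : γ * ((F.L : ℝ)⁻¹) ^ (K - j) ≤ 1 := by
    have h1 : ((F.L : ℝ)⁻¹) ^ (K - j) ≤ 1 := pow_le_one₀ (inv_nonneg.mpr hL0.le) (inv_le_one_of_one_le₀ hL1)
    calc γ * ((F.L : ℝ)⁻¹) ^ (K - j) ≤ 1 * 1 := mul_le_mul hγ1 h1 (pow_nonneg (inv_nonneg.mpr hL0.le) _) zero_le_one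
      _ = 1 := one_mul 1
  exact (one_le_inv₀ hq0).mpr hq1


/-- The two depth ranges of the route merge to ONE ladder-uniform sandwich bound at all constrained heights `j ≥ 1` (`n ≥ 2`),
with a non-negative constant (`C = |C₁| + |C₂|`, `γ₁ = min`, `c = min`, `N = N₁' + N₂'`). -/
theorem allDepths_of (hF : SandwichFractionalWindowTailL) (hD : SandwichDeepWindowTailL) (L : ℕ) (b₀ p₀ Λ : ℝ)
    (hb₀ : 0 < b₀) (hp₀ : 2 < p₀) (hΛ : 1 < Λ) :
    ∃ (γ₁ C c : ℝ) (N : ℕ), 0 < γ₁ ∧ γ₁ ≤ 1 ∧ 0 ≤ C ∧ 0 < c ∧ ∀ (F : T3Family) (γ : ℝ), F.L = L → 0 < γ → γ ≤ γ₁ →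
      ∀ (b : ℝ), b₀ ≤ b → ∀ (K n j : ℕ), 1 ≤ j → 2 ≤ n → j + n ≤ K → ∀ p : Plaq (F.P K) j,
        (gibbsK F ℰp γ K).real
          {U | (∀ k, k < j → PlaqSmall (θBal F.L γ b p₀ (K - k))
                (Averaging.iter (fun i => BlockAveraging.blockAvg (P := F.P K) (j := i) ℰp) k U)) ∧
              (∀ j', j ≤ j' → j' + n ≤ K → PlaqSmall (θBal F.L γ (Λ * b) p₀ (K - j'))
                (Averaging.iter (fun i => BlockAveraging.blockAvg (P := F.P K) (j := i) ℰp) j' U)) ∧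
              θBal F.L γ b p₀ (K - j) ≤ dist1 (GaugeField.plaqHol
                (Averaging.iter (fun i => BlockAveraging.blockAvg (P := F.P K) (j := i) ℰp) j U) p)}
        ≤ C * ((γ * ((F.L : ℝ)⁻¹) ^ (K - j))⁻¹) ^ N *
            Real.exp (-(c * B10.pFun b₀ p₀ (Real.sqrt (γ * ((F.L : ℝ)⁻¹) ^ (K - j))) ^ 2)) := by
  obtain ⟨N₁, hN₁, hF'⟩ := hF L
  obtain ⟨γa, Ca, ca, Na, hγa, hγa1, hca, hA⟩ := hF' b₀ p₀ Λ hb₀ hp₀ hΛ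
  obtain ⟨γb, Cb, cb, Nb, hγb, hγb1, hcb, hB⟩ := hD L N₁ hN₁ b₀ p₀ Λ hb₀ hp₀ hΛ
  refine ⟨min γa γb, |Ca| + |Cb|, min ca cb, Na + Nb, lt_min hγa hγb, (min_le_left _ _).trans hγa1,
    by positivity, lt_min hca hcb, ?_⟩
  intro F γ hFL hγ hγ1 b hb K n j hj1 hn hjK p
  have hγa' : γ ≤ γa := hγ1.trans (min_le_left _ _)
  have hγb' : γ ≤ γb := hγ1.trans (min_le_right _ _)
  have hβ := sd_one_le_beta F hγ (hγa'.trans hγa1) K j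
  have ht : (0 : ℝ) ≤ B10.pFun b₀ p₀ (Real.sqrt (γ * ((F.L : ℝ)⁻¹) ^ (K - j))) ^ 2 := sq_nonneg _
  have hCa : |Ca| ≤ |Ca| + |Cb| := by linarith [abs_nonneg Cb]
  have hCb : |Cb| ≤ |Ca| + |Cb| := by linarith [abs_nonneg Ca]
  by_cases hr : N₁ * j + n ≤ K
  · exact sd_schema_mono hβ (by omega) (min_le_left _ _) ht hCa (hA F γ hFL hγ hγa' b hb K n j hr p)
  · exact sd_schema_mono hβ (by omega) (min_le_right _ _) ht hCb
      (hB F γ hFL hγ hγb' b hb K n j hj1 hn hjK (by omega) p)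

/-- **THE DOOR, PROVED** (support item `HistoryTailOfSandwichSplit` of the repaired route): the fractional and deep sandwich tails
give the body of `UnitScaleTilt.HistoryTailL` — profile `(b₀, p₀) = (max b₁ 1, max p₁ 3)`, ladder ratio `Λ = 2`, `γ₁ = min`, the
landed bare tail `T3BareTailProfile.bareTailAt`, and the reduction `historyTailAt_of_bare_sandwich` (severity-maximal sandwich re-cover).
Conditional bookkeeping only: neither sandwich tail is proved here, and nothing bears on the rung R3 or the mass gap. -/
theorem door : HistoryTailOfSandwichSplit := by
  intro hF hD L b₁ p₁
  obtain ⟨b₀, hb₁, hb₀1⟩ : ∃ b₀ : ℝ, b₁ ≤ b₀ ∧ 1 ≤ b₀ := ⟨max b₁ 1, le_max_left _ _, le_max_right _ _⟩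
  obtain ⟨p₀, hp₁, hp₀⟩ : ∃ p₀ : ℝ, p₁ ≤ p₀ ∧ 2 < p₀ :=
    ⟨max p₁ 3, le_max_left _ _, lt_of_lt_of_le (by norm_num) (le_max_right _ _)⟩
  have hb₀ : 0 < b₀ := one_pos.trans_le hb₀1
  have hp₀1 : 1 ≤ p₀ := by linarith
  obtain ⟨γ₁, C, c, N, hγ₁, hγ₁1, hC, hc, hall⟩ := allDepths_of hF hD L b₀ p₀ 2 hb₀ hp₀ one_lt_two
  refine ⟨b₀, p₀, hb₁, hp₁, hb₀, hp₀, fun m hm => ⟨γ₁, hγ₁, fun F γ hFL hγ hle => ?_⟩⟩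
  have hγ1 : γ ≤ 1 := hle.trans hγ₁1
  obtain ⟨q₀, hq₀0, hq₀, -, hbare⟩ := bareTailAt F hγ hγ1 hb₀ hp₀1
  exact historyTailAt_of_bare_sandwich F hγ hγ1 hb₀1 hp₀1 hm q₀ hq₀0 hq₀ hbare hC hc N
    (fun b hb K n j hj hn hjK p => hall F γ hFL hγ hle b hb K n j hj hn hjK p)

end Door

end SandwichDischargeDoor

/-- **The route item `HistoryTailOfSandwichSplit` (support, rank 9) of route-QuantumFields-CovariantDischarge rev 1, PROVED.** -/
theorem covariantDischarge_historyTailOfSandwichSplit_proof :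
    Summit.QuantumFields.YangMills.Theses.CovariantDischarge.HistoryTailOfSandwichSplit :=
  SandwichDischargeDoor.door

end Summit.QuantumFields.YangMills.Theorems

end
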